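import Summits.QuantumFields.BalabanUV.Beta.EriceFlowEnclosureInverseLawAllOrders

/-!
# Beta / EriceFlowEnclosurePolyLogInversion — THE POLYLOGARITHMIC CLASS IS CLOSED UNDER INVERSION (pure real analysis, SERVICE):
# if `φ y = y + Σ_{k ≤ N} P_k(log y)∕y^k + O((1 + log y)^d∕y^{N+1})` at ∞ and ψ → ∞ is an (approximate) right inverse of φ at ∞,
# `|φ(ψ s) − s| ≤ B·(1 + log s)^e∕s^{N+1}` eventually, then `ψ s = s + Σ_{k ≤ N} Q_k(log s)∕s^k + O((1 + log s)^{d′}∕s^{N+1})` with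
# Q_0 = −P_0, and the letters Q of ψ are FORCED (β-flow team, prover 2 = lower ∕ positivity side, unit `b2b-balaban-beta-bflow-p2`,
# gen 22; module P2 #36i; over P2 #36g-A `…PolyLogLetters`, P2 #36g-B `…PolyLogClosure` (the letter calculus) and P2 #36g
# `…InverseLawAllOrders` (`polyLog_letters_unique`); consumer: P2 #36j `…LambdaPolyLog` — THE Λ-FORM OF THE INVERSE LAW, the σ-side
# converse suggested by bflow-p1 g18 [BFLOW-P1-G18-INTENT46H])

HONEST FRAMING (page 1 of everything the β sub-cell writes): discharging `BetaPertH` makes Bałaban's UV stability UNCONDITIONAL — a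
real constructive-QFT result; it is NOT the continuum limit and NOT the Clay problem.  HONEST DEPENDENCY (cell reorg 2026-08-19,
verbatim): «continuum YM on T⁴ ⇐ BetaPertH ∧ nine spine estimates (0/9 proved); BetaPertH ⇐ (D1) ∧ (D4) ∧ CAP+tail; G-an2-4 gates
asym, D1 and NE2/3/4.»  THIS MODULE DISCHARGES NOTHING: [folklore] real analysis of two real functions; no Erice sentence is consumed;
nothing of (1.22); no flow, no β, no Λ appears — the letters P, Q are ABSTRACT.

THE POINT (the induction of P2 #36g `inverse_law_allOrders` with the roles of y and s exchanged).  A priori `|ψ s − s| ≤ c(1 + log s)^D`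
(crude bound of φ − id at y = ψ s, and ψ s ≤ 4s because `(1 + log y)^D = o(y)`), so `v := (ψ s − s)∕s` is PL at order 0 WITHOUT constant
letter.  STEP at order M: if v is PL at order M without constant letter then |v| ≤ ½ eventually, `log ψ s = log s + log(1 + v)` is PL
with constant letter X, `P_k(log ψ s)` is PL with constant letter P_k (`polyLog_polyEval`), `1∕(ψ s)^k = (1 + v)^{−k}∕s^k` is PL without
constant letter for k ≥ 1, the error of φ at y = ψ s ∈ [s∕2, 2s] is `O((1 + log s)^d∕s^{M+1})`, and
`ψ s − s = −(P_0(log ψ s) + Σ_{1≤k≤M} P_k(log ψ s)∕(ψ s)^k + E_φ(ψ s)) + (φ(ψ s) − s)` EXACTLY — a sum of PL functions at order M whose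
constant letters add up to −P_0; then v is PL at order M + 1 without constant letter (`polyLog_shift`) and the step runs again.

WHAT THIS FILE PROVES (0 sorry, 0 def, all [folklore]):
§1 `polyLog_polyEval` ∕ `polyLog_polyEval_X` (a polynomial of a PL function is PL; constant letter `Σ_i C(q_i)·H_0^i`, = Q when H_0 = X);
§2 `defect_mono`, `defect_of_rightInverse`, `inverse_apriori` (`|ψ s − s| ≤ c(1 + log s)^D`);  §3 `inverse_step` (THE STEP above);
§4 HEADLINE **`polyLog_inverse`** (∀ N: the expansion of ψ − id at order N with Q 0 = −P 0), **`polyLog_inverse_unique`** (any letters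
   carrying such a bound for ψ agree with Q up to N), **`polyLog_inverse_inverse`** (two-sided pair: the inverse letters of the letters
   of ψ are the letters of φ again), **`polyLog_inverse_asymptoticSeries`** (ONE P at every order ⟹ ONE Q at every order).
NOT CLAIMED: the letters Q_k (k ≥ 1) in closed form (Q_1 = −P_1 + P_0·P_0′ when deg P_0 ≤ 1 — not tracked); degrees and the error
exponent; CANONICITY of Q in P across different realizations (φ, ψ) — that is the companion P2 #36k `…PolyLogInversionCanonical`
(two approximate inverses of maps with the same letters are O((1 + log s)^D∕s^{N+1})-close because the letter sum is ½-Lipschitz near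
∞ by the mean value inequality); anything about β, Λ, σ (that is P2 #36j); (1.22); `BetaPertH`; continuum; Clay.
-/
namespace Summit.QuantumFields.BalabanUV.Beta.EriceFlowEnclosurePolyLogInversion

open Set Filter Topology
open Summit.QuantumFields.BalabanUV.Beta.EriceFlowEnclosurePolyLogLetters
open Summit.QuantumFields.BalabanUV.Beta.EriceFlowEnclosurePolyLogClosure
open Summit.QuantumFields.BalabanUV.Beta.EriceFlowEnclosureInverseLawAllOrders
  (tendsto_one_add_log_pow_div polyLog_letters_unique)

noncomputable section

/-! ## §1 A polynomial of a PL function is PL -/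

/-- **A POLYNOMIAL OF A PL FUNCTION IS PL**: if `h` has a polylogarithmic expansion at order N with letters H, then so has `Q(h)`, with
constant letter `Σ_{i ≤ deg Q} C(q_i)·(H 0)^i` (powers: P2 #36g-B `polyLog_pow`; then `polyLog_const_mul`, `polyLog_sum`). [folklore] -/
theorem polyLog_polyEval {N : ℕ} {h : ℝ → ℝ} {H : ℕ → Polynomial ℝ} {A : ℝ} {d : ℕ} (Q : Polynomial ℝ)
    (hh : ∀ᶠ y : ℝ in atTop, |h y - ∑ k ∈ Finset.range (N + 1), (H k).eval (Real.log y) / y ^ k|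
      ≤ A * (1 + Real.log y) ^ d / y ^ (N + 1)) :
    ∃ (R : ℕ → Polynomial ℝ) (A' : ℝ) (d' : ℕ),
      R 0 = ∑ i ∈ Finset.range (Q.natDegree + 1), Polynomial.C (Q.coeff i) * (H 0) ^ i ∧
      ∀ᶠ y : ℝ in atTop, |Q.eval (h y) - ∑ k ∈ Finset.range (N + 1), (R k).eval (Real.log y) / y ^ k|
        ≤ A' * (1 + Real.log y) ^ d' / y ^ (N + 1) := by
  have hS : ∀ i : ℕ, ∃ (Ri : ℕ → Polynomial ℝ) (Ai : ℝ) (di : ℕ), Ri 0 = Polynomial.C (Q.coeff i) * (H 0) ^ i ∧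
      ∀ᶠ y : ℝ in atTop, |Q.coeff i * h y ^ i - ∑ k ∈ Finset.range (N + 1), (Ri k).eval (Real.log y) / y ^ k|
        ≤ Ai * (1 + Real.log y) ^ di / y ^ (N + 1) := by
    intro i
    obtain ⟨Rp, Ap, dp, hRp0, hp⟩ := polyLog_pow hh i
    exact ⟨fun k => Polynomial.C (Q.coeff i) * Rp k, _, _, by dsimp only; rw [hRp0], polyLog_const_mul (Q.coeff i) hp⟩
  choose Ri Ai di hRi0 hRi using hS
  obtain ⟨AS, dS, hsum⟩ := polyLog_sum (N := N) (fun i y => Q.coeff i * h y ^ i) (fun i k => Ri i k)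
    (Q.natDegree + 1) (fun i _ => ⟨Ai i, di i, hRi i⟩)
  refine ⟨fun k => ∑ i ∈ Finset.range (Q.natDegree + 1), Ri i k, AS, dS, ?_, ?_⟩
  · exact Finset.sum_congr rfl fun i _ => hRi0 i
  · refine polyLog_congr hsum (Eventually.of_forall fun y => ?_)
    rw [Polynomial.eval_eq_sum_range]

/-- `polyLog_polyEval` when the constant letter of `h` is X (the case `h = log y + PL₀`): the constant letter of `Q(h)` is Q. [folklore] -/
theorem polyLog_polyEval_X {N : ℕ} {h : ℝ → ℝ} {H : ℕ → Polynomial ℝ} {A : ℝ} {d : ℕ} (Q : Polynomial ℝ)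
    (hh : ∀ᶠ y : ℝ in atTop, |h y - ∑ k ∈ Finset.range (N + 1), (H k).eval (Real.log y) / y ^ k|
      ≤ A * (1 + Real.log y) ^ d / y ^ (N + 1)) (hH0 : H 0 = Polynomial.X) :
    ∃ (R : ℕ → Polynomial ℝ) (A' : ℝ) (d' : ℕ), R 0 = Q ∧
      ∀ᶠ y : ℝ in atTop, |Q.eval (h y) - ∑ k ∈ Finset.range (N + 1), (R k).eval (Real.log y) / y ^ k|
        ≤ A' * (1 + Real.log y) ^ d' / y ^ (N + 1) := by
  obtain ⟨R, A', d', hR0, hR⟩ := polyLog_polyEval Q hh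
  refine ⟨R, A', d', ?_, hR⟩
  rw [hR0, hH0]
  exact (Polynomial.as_sum_range_C_mul_X_pow Q).symm

/-! ## §2 A priori bounds -/

/-- An approximate identity `|φ(ψ s) − s| ≤ B·(1 + log s)^e∕s^{N+1}` at order N is one at every order M ≤ N (constant |B|). [folklore] -/
theorem defect_mono {φ ψ : ℝ → ℝ} {B : ℝ} {e N M : ℕ} (hMN : M ≤ N)
    (hinv : ∀ᶠ s : ℝ in atTop, |φ (ψ s) - s| ≤ B * (1 + Real.log s) ^ e / s ^ (N + 1)) :
    ∀ᶠ s : ℝ in atTop, |φ (ψ s) - s| ≤ |B| * (1 + Real.log s) ^ e / s ^ (M + 1) := by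
  filter_upwards [hinv, eventually_ge_atTop (1 : ℝ)] with s hs hs1
  have hL : 0 ≤ Real.log s := Real.log_nonneg hs1
  have hpow : s ^ (M + 1) ≤ s ^ (N + 1) := pow_le_pow_right₀ hs1 (by omega)
  have hsM : 0 < s ^ (M + 1) := pow_pos (by linarith) _
  calc |φ (ψ s) - s| ≤ B * (1 + Real.log s) ^ e / s ^ (N + 1) := hs
    _ ≤ |B| * (1 + Real.log s) ^ e / s ^ (N + 1) :=
        div_le_div_of_nonneg_right (mul_le_mul_of_nonneg_right (le_abs_self B) (by positivity)) (by positivity)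
    _ ≤ |B| * (1 + Real.log s) ^ e / s ^ (M + 1) := div_le_div_of_nonneg_left (by positivity) hsM hpow

/-- An exact right inverse has defect 0 at every order. [folklore] -/
theorem defect_of_rightInverse {φ ψ : ℝ → ℝ} (N : ℕ) (hinv : ∀ᶠ s : ℝ in atTop, φ (ψ s) = s) :
    ∀ᶠ s : ℝ in atTop, |φ (ψ s) - s| ≤ 0 * (1 + Real.log s) ^ 0 / s ^ (N + 1) := by
  filter_upwards [hinv] with s hs
  rw [hs, sub_self, abs_zero, zero_mul, zero_div]

/-- **A PRIORI**: if `φ − id` is PL at some order (letters P), ψ → ∞ and `|φ(ψ s) − s| ≤ B·(1 + log s)^e∕s^{N+1}` eventually, then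
`|ψ s − s| ≤ c·(1 + log s)^D` eventually — the crude bound `|φ y − y| ≤ c₀(1 + log y)^D` (P2 #36g-A `abs_le_of_polyLog`) at y = ψ s
and `c₀(1 + log y)^D ≤ y∕2` for large y give ψ s ≤ 4s, whence `1 + log ψ s ≤ 4(1 + log s)`. [folklore] -/
theorem inverse_apriori {N : ℕ} {φ ψ : ℝ → ℝ} {P : ℕ → Polynomial ℝ} {A B : ℝ} {d e : ℕ}
    (hφ : ∀ᶠ y : ℝ in atTop, |(φ y - y) - ∑ k ∈ Finset.range (N + 1), (P k).eval (Real.log y) / y ^ k|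
      ≤ A * (1 + Real.log y) ^ d / y ^ (N + 1))
    (hψ : Tendsto ψ atTop atTop) (hinv : ∀ᶠ s : ℝ in atTop, |φ (ψ s) - s| ≤ B * (1 + Real.log s) ^ e / s ^ (N + 1)) :
    ∃ c : ℝ, ∃ D : ℕ, 0 ≤ c ∧ ∀ᶠ s : ℝ in atTop, |ψ s - s| ≤ c * (1 + Real.log s) ^ D := by
  obtain ⟨c, D, hc, hb⟩ := abs_le_of_polyLog hφ
  -- c·(1 + log y)^D ≤ y/2 eventually
  have hlim : Tendsto (fun y : ℝ => c * ((1 + Real.log y) ^ D / y)) atTop (𝓝 (c * 0)) :=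
    (tendsto_one_add_log_pow_div D).const_mul c
  rw [mul_zero] at hlim
  have hhalf : ∀ᶠ y : ℝ in atTop, c * (1 + Real.log y) ^ D ≤ y / 2 := by
    filter_upwards [hlim.eventually (gt_mem_nhds (by norm_num : (0 : ℝ) < 1 / 2)), eventually_gt_atTop (0 : ℝ)]
      with y hy hy0
    rw [← mul_div_assoc, div_lt_iff₀ hy0] at hy
    linarith
  -- the defect is ≤ 1 eventually
  have hdl : Tendsto (fun s : ℝ => |B| * ((1 + Real.log s) ^ e / s)) atTop (𝓝 (|B| * 0)) :=
    (tendsto_one_add_log_pow_div e).const_mul |B|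
  rw [mul_zero] at hdl
  have hdef : ∀ᶠ s : ℝ in atTop, |φ (ψ s) - s| ≤ 1 := by
    filter_upwards [hinv, hdl.eventually (gt_mem_nhds (by norm_num : (0 : ℝ) < 1)), eventually_ge_atTop (1 : ℝ)]
      with s hs hl1 hs1
    have hL : 0 ≤ Real.log s := Real.log_nonneg hs1
    have hsN : s ≤ s ^ (N + 1) := le_self_pow₀ hs1 (by omega)
    calc |φ (ψ s) - s| ≤ B * (1 + Real.log s) ^ e / s ^ (N + 1) := hs
      _ ≤ |B| * (1 + Real.log s) ^ e / s ^ (N + 1) :=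
          div_le_div_of_nonneg_right (mul_le_mul_of_nonneg_right (le_abs_self B) (by positivity)) (by positivity)
      _ ≤ |B| * (1 + Real.log s) ^ e / s := div_le_div_of_nonneg_left (by positivity) (by linarith) hsN
      _ = |B| * ((1 + Real.log s) ^ e / s) := mul_div_assoc _ _ _
      _ ≤ 1 := hl1.le
  have hT := hψ.eventually (hb.and (hhalf.and (eventually_ge_atTop (1 : ℝ))))
  refine ⟨c * 4 ^ D + 1, D, by positivity, ?_⟩
  filter_upwards [hT, hdef, eventually_ge_atTop (1 : ℝ)] with s hs hB hs1
  obtain ⟨hbs, hhs, hψ1⟩ := hs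
  have hL : 0 ≤ Real.log s := Real.log_nonneg hs1
  have hLψ : 0 ≤ Real.log (ψ s) := Real.log_nonneg hψ1
  -- |ψ s − s| ≤ |φ(ψ s) − s| + |φ(ψ s) − ψ s|
  have htri : |ψ s - s| ≤ c * (1 + Real.log (ψ s)) ^ D + 1 := by
    have e1 : ψ s - s = (φ (ψ s) - s) - (φ (ψ s) - ψ s) := by ring
    rw [e1]
    refine (abs_sub _ _).trans ?_
    linarith
  have hψle : ψ s ≤ 4 * s := by
    have := (le_abs_self _).trans htri
    linarith
  have hlogψ : Real.log (ψ s) ≤ 3 + Real.log s := by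
    have h := Real.log_le_log (by linarith) hψle
    rw [Real.log_mul (by norm_num) (by linarith)] at h
    have h4 : Real.log 4 ≤ 4 - 1 := Real.log_le_sub_one_of_pos (by norm_num)
    linarith
  have hcmp : 1 + Real.log (ψ s) ≤ 4 * (1 + Real.log s) := by linarith
  have hpowcmp : (1 + Real.log (ψ s)) ^ D ≤ 4 ^ D * (1 + Real.log s) ^ D := by
    rw [← mul_pow]; exact pow_le_pow_left₀ (by linarith) hcmp D
  have h1D : 1 ≤ (1 + Real.log s) ^ D := one_le_pow₀ (by linarith)
  calc |ψ s - s| ≤ c * (1 + Real.log (ψ s)) ^ D + 1 := htri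
    _ ≤ c * (4 ^ D * (1 + Real.log s) ^ D) + (1 + Real.log s) ^ D :=
        add_le_add (mul_le_mul_of_nonneg_left hpowcmp hc) h1D
    _ = (c * 4 ^ D + 1) * (1 + Real.log s) ^ D := by ring

/-! ## §3 The step -/

/-- **THE STEP** (module docstring): `φ − id` PL at order M with letters P, ψ → ∞, defect at order M, and `v := (ψ s − s)∕s` PL at order
M WITHOUT constant letter ⟹ `ψ − id` is PL at order M with constant letter −P_0. [folklore] -/
theorem inverse_step {M : ℕ} {φ ψ : ℝ → ℝ} {P : ℕ → Polynomial ℝ} {A B : ℝ} {d e : ℕ}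
    (hφ : ∀ᶠ y : ℝ in atTop, |(φ y - y) - ∑ k ∈ Finset.range (M + 1), (P k).eval (Real.log y) / y ^ k|
      ≤ A * (1 + Real.log y) ^ d / y ^ (M + 1))
    (hψ : Tendsto ψ atTop atTop)
    (hinv : ∀ᶠ s : ℝ in atTop, |φ (ψ s) - s| ≤ B * (1 + Real.log s) ^ e / s ^ (M + 1))
    {V : ℕ → Polynomial ℝ} {AV : ℝ} {dV : ℕ} (hV0 : V 0 = 0)
    (hv : ∀ᶠ s : ℝ in atTop, |(ψ s - s) / s - ∑ k ∈ Finset.range (M + 1), (V k).eval (Real.log s) / s ^ k|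
      ≤ AV * (1 + Real.log s) ^ dV / s ^ (M + 1)) :
    ∃ (Q : ℕ → Polynomial ℝ) (A' : ℝ) (d' : ℕ), Q 0 = -P 0 ∧ 0 ≤ A' ∧
      ∀ᶠ s : ℝ in atTop, |(ψ s - s) - ∑ k ∈ Finset.range (M + 1), (Q k).eval (Real.log s) / s ^ k|
        ≤ A' * (1 + Real.log s) ^ d' / s ^ (M + 1) := by
  -- |v| ≤ 1/2 eventually
  obtain ⟨cv, Dv, -, hvb⟩ := abs_le_div_of_polyLog hv hV0
  have hvlim : Tendsto (fun s : ℝ => cv * ((1 + Real.log s) ^ Dv / s)) atTop (𝓝 (cv * 0)) :=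
    (tendsto_one_add_log_pow_div Dv).const_mul cv
  rw [mul_zero] at hvlim
  have hsmall : ∀ᶠ s : ℝ in atTop, |(ψ s - s) / s| ≤ 1 / 2 := by
    filter_upwards [hvb, hvlim.eventually (gt_mem_nhds (by norm_num : (0 : ℝ) < 1 / 2))] with s hs hl
    exact hs.trans (by rw [mul_div_assoc]; exact hl.le)
  -- the PL functions log(1 + v), (1 + v)⁻¹, log s + log(1 + v) = log ψ s
  obtain ⟨RL, AL, dL, hRL0, hlog⟩ := polyLog_log_one_add hv hV0 hsmall
  obtain ⟨RU, AU, dU, -, hu⟩ := polyLog_inv_one_add hv hV0 hsmall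
  have hX := polyLog_of_poly (Polynomial.X : Polynomial ℝ) M
  obtain ⟨A₁, d₁, hlogψ⟩ := polyLog_add hX hlog
  have hH0 : (fun k : ℕ => (if k = 0 then (Polynomial.X : Polynomial ℝ) else 0) + RL k) 0 = Polynomial.X := by
    simp [hRL0]
  -- the k = 0 term P_0(log ψ s) and the terms P_{k+1}(log ψ s)∕(ψ s)^{k+1}
  obtain ⟨R0, A0, d0, hR00, hT0⟩ := polyLog_polyEval_X (P 0) hlogψ hH0
  have hS : ∀ k : ℕ, ∃ (Rk : ℕ → Polynomial ℝ) (Ak : ℝ) (dk : ℕ), Rk 0 = 0 ∧ ∀ᶠ s : ℝ in atTop,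
      |(P (k + 1)).eval ((Polynomial.X : Polynomial ℝ).eval (Real.log s) + Real.log (1 + (ψ s - s) / s))
          * (1 + (ψ s - s) / s)⁻¹ ^ (k + 1) / s ^ (k + 1)
        - ∑ j ∈ Finset.range (M + 1), (Rk j).eval (Real.log s) / s ^ j| ≤ Ak * (1 + Real.log s) ^ dk / s ^ (M + 1) := by
    intro k
    obtain ⟨Re, Ae, de, -, he⟩ := polyLog_polyEval (P (k + 1)) hlogψ
    obtain ⟨Rp, Ap, dp, -, hp⟩ := polyLog_pow hu (k + 1)
    obtain ⟨Rm, Am, dm, -, hm⟩ := polyLog_mul M he hp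
    obtain ⟨Rk, Ak, dk, h0, hk⟩ := polyLog_div_pow hm (k + 1)
    exact ⟨Rk, Ak, dk, h0 (Nat.succ_pos k), hk⟩
  choose RS AS dS hRS0 hRS using hS
  obtain ⟨ASum, dSum, hSum⟩ := polyLog_sum (N := M)
    (fun k s => (P (k + 1)).eval ((Polynomial.X : Polynomial ℝ).eval (Real.log s) + Real.log (1 + (ψ s - s) / s))
        * (1 + (ψ s - s) / s)⁻¹ ^ (k + 1) / s ^ (k + 1))
    (fun k j => RS k j) M (fun k _ => ⟨_, _, hRS k⟩)
  -- the error of φ at y = ψ s ∈ [s/2, 2s]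
  have hT := hψ.eventually ((polyLog_abs_const hφ).and (eventually_ge_atTop (1 : ℝ)))
  have hE : ∀ᶠ s : ℝ in atTop,
      |(φ (ψ s) - ψ s) - ∑ k ∈ Finset.range (M + 1), (P k).eval (Real.log (ψ s)) / ψ s ^ k|
        ≤ |A| * 2 ^ d * 2 ^ (M + 1) * (1 + Real.log s) ^ d / s ^ (M + 1) := by
    filter_upwards [hT, hsmall, eventually_ge_atTop (1 : ℝ)] with s hs hvs hs1
    obtain ⟨hEs, hψ1⟩ := hs
    have hs0 : 0 < s := by linarith
    have hL : 0 ≤ Real.log s := Real.log_nonneg hs1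
    have hLψ : 0 ≤ Real.log (ψ s) := Real.log_nonneg hψ1
    obtain ⟨hlo', hhi'⟩ := abs_le.1 hvs
    rw [le_div_iff₀ hs0] at hlo'
    rw [div_le_iff₀ hs0] at hhi'
    have hlo : s / 2 ≤ ψ s := by linarith
    have hhi : ψ s ≤ 2 * s := by linarith
    have hlψ : Real.log (ψ s) ≤ 1 + Real.log s := by
      have h := Real.log_le_log (by linarith) hhi
      rw [Real.log_mul (by norm_num) hs0.ne'] at h
      have h2 : Real.log 2 ≤ 2 - 1 := Real.log_le_sub_one_of_pos (by norm_num)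
      linarith
    have hcmp : (1 + Real.log (ψ s)) ^ d ≤ 2 ^ d * (1 + Real.log s) ^ d := by
      rw [← mul_pow]; exact pow_le_pow_left₀ (by linarith) (by linarith) d
    have hden : (s / 2) ^ (M + 1) ≤ ψ s ^ (M + 1) := pow_le_pow_left₀ (by positivity) hlo _
    have hsp : 0 < (s / 2) ^ (M + 1) := by positivity
    calc |(φ (ψ s) - ψ s) - ∑ k ∈ Finset.range (M + 1), (P k).eval (Real.log (ψ s)) / ψ s ^ k|
        ≤ |A| * (1 + Real.log (ψ s)) ^ d / ψ s ^ (M + 1) := hEs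
      _ ≤ |A| * (2 ^ d * (1 + Real.log s) ^ d) / ψ s ^ (M + 1) :=
          div_le_div_of_nonneg_right (mul_le_mul_of_nonneg_left hcmp (abs_nonneg A)) (by positivity)
      _ ≤ |A| * (2 ^ d * (1 + Real.log s) ^ d) / (s / 2) ^ (M + 1) :=
          div_le_div_of_nonneg_left (by positivity) hsp hden
      _ = |A| * 2 ^ d * 2 ^ (M + 1) * (1 + Real.log s) ^ d / s ^ (M + 1) := by
          rw [div_pow]
          field_simp
  have p4 := polyLog_of_error hE
  have p5 := polyLog_of_error hinv
  -- assembly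
  obtain ⟨A₅, d₅, p12⟩ := polyLog_add hT0 hSum
  obtain ⟨A₆, d₆, p123⟩ := polyLog_add p12 p4
  have p6 := polyLog_const_mul (-1 : ℝ) p123
  obtain ⟨A₇, d₇, p7⟩ := polyLog_add p6 p5
  -- the exact identity ψ s − s = −(P_0(log ψ s) + Σ_{k<M} P_{k+1}(log ψ s)/(ψ s)^{k+1} + E_φ(ψ s)) + (φ(ψ s) − s)
  have hident : ∀ᶠ s : ℝ in atTop,
      (-1) * ((P 0).eval ((Polynomial.X : Polynomial ℝ).eval (Real.log s) + Real.log (1 + (ψ s - s) / s))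
          + ∑ k ∈ Finset.range M,
              (P (k + 1)).eval ((Polynomial.X : Polynomial ℝ).eval (Real.log s) + Real.log (1 + (ψ s - s) / s))
                * (1 + (ψ s - s) / s)⁻¹ ^ (k + 1) / s ^ (k + 1)
          + ((φ (ψ s) - ψ s) - ∑ k ∈ Finset.range (M + 1), (P k).eval (Real.log (ψ s)) / ψ s ^ k))
        + (φ (ψ s) - s) = ψ s - s := by
    filter_upwards [hsmall, eventually_gt_atTop (0 : ℝ)] with s hvs hs0
    have hv1 : 0 < 1 + (ψ s - s) / s := by
      have h := (abs_le.1 hvs).1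
      linarith
    have h1v : 1 + (ψ s - s) / s = ψ s / s := by
      field_simp
      ring
    have hψ0 : 0 < ψ s := by
      have h : 0 < ψ s / s := h1v ▸ hv1
      exact (div_pos_iff_of_pos_right hs0).1 h
    have hlg : (Polynomial.X : Polynomial ℝ).eval (Real.log s) + Real.log (1 + (ψ s - s) / s) = Real.log (ψ s) := by
      rw [Polynomial.eval_X, h1v, Real.log_div hψ0.ne' hs0.ne']
      ring
    have hterm : ∀ k : ℕ,
        (P k).eval ((Polynomial.X : Polynomial ℝ).eval (Real.log s) + Real.log (1 + (ψ s - s) / s))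
          * (1 + (ψ s - s) / s)⁻¹ ^ k / s ^ k = (P k).eval (Real.log (ψ s)) / ψ s ^ k := by
      intro k
      rw [hlg, h1v, inv_div, div_pow]
      field_simp
    rw [Finset.sum_congr rfl fun k _ => hterm (k + 1), hlg, Finset.sum_range_succ']
    simp only [pow_zero, div_one]
    ring
  refine ⟨_, |A₇|, d₇, ?_, abs_nonneg _, polyLog_abs_const (polyLog_congr p7 hident)⟩
  simp [hR00, hRS0]

/-! ## §4 The inversion theorem -/

/-- **THE POLYLOGARITHMIC CLASS IS CLOSED UNDER INVERSION.**  For every N: if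
`|φ y − y − Σ_{k ≤ N} P_k(log y)∕y^k| ≤ A·(1 + log y)^d∕y^{N+1}` eventually, ψ → ∞ along atTop, and
`|φ(ψ s) − s| ≤ B·(1 + log s)^e∕s^{N+1}` eventually (an exact right inverse: `defect_of_rightInverse`), then there are letters
`Q : ℕ → ℝ[X]` with **Q 0 = −P 0**, a constant A′ ≥ 0 and an exponent d′ with, eventually,
`|ψ s − s − Σ_{k ≤ N} Q_k(log s)∕s^k| ≤ A′·(1 + log s)^{d′}∕s^{N+1}`.  Induction on N: the base is `inverse_step` at order 0 fed by
`inverse_apriori`; the step truncates φ's expansion (`polyLog_truncate_succ`), inverts at order N, shifts (`polyLog_shift`) and runs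
`inverse_step` at order N + 1. [folklore] -/
theorem polyLog_inverse : ∀ (N : ℕ) {φ ψ : ℝ → ℝ} {P : ℕ → Polynomial ℝ} {A B : ℝ} {d e : ℕ},
    (∀ᶠ y : ℝ in atTop, |(φ y - y) - ∑ k ∈ Finset.range (N + 1), (P k).eval (Real.log y) / y ^ k|
      ≤ A * (1 + Real.log y) ^ d / y ^ (N + 1)) →
    Tendsto ψ atTop atTop →
    (∀ᶠ s : ℝ in atTop, |φ (ψ s) - s| ≤ B * (1 + Real.log s) ^ e / s ^ (N + 1)) →
    ∃ (Q : ℕ → Polynomial ℝ) (A' : ℝ) (d' : ℕ), Q 0 = -P 0 ∧ 0 ≤ A' ∧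
      ∀ᶠ s : ℝ in atTop, |(ψ s - s) - ∑ k ∈ Finset.range (N + 1), (Q k).eval (Real.log s) / s ^ k|
        ≤ A' * (1 + Real.log s) ^ d' / s ^ (N + 1) := by
  intro N
  induction N with
  | zero =>
    intro φ ψ P A B d e hφ hψ hinv
    obtain ⟨c, D, -, hb⟩ := inverse_apriori hφ hψ hinv
    have hv : ∀ᶠ s : ℝ in atTop, |(ψ s - s) / s| ≤ c * (1 + Real.log s) ^ D / s ^ (0 + 1) := by
      filter_upwards [hb, eventually_gt_atTop (0 : ℝ)] with s hs hs0
      rw [zero_add, pow_one, abs_div, abs_of_pos hs0]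
      exact div_le_div_of_nonneg_right hs hs0.le
    exact inverse_step hφ hψ hinv rfl (polyLog_of_error hv)
  | succ N ih =>
    intro φ ψ P A B d e hφ hψ hinv
    obtain ⟨A₁, d₁, hφN⟩ := polyLog_truncate_succ hφ
    obtain ⟨Q, A', d', -, -, hQ⟩ := ih hφN hψ (defect_mono (Nat.le_succ N) hinv)
    exact inverse_step hφ hψ hinv (V := fun k => if k = 0 then (0 : Polynomial ℝ) else Q (k - 1)) (by simp)
      (polyLog_shift hQ)

/-- **…AND THE INVERSE LETTERS ARE FORCED**: under the hypotheses of `polyLog_inverse` at order N, ANY letters Q′ carrying such a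
bound for `ψ − id` (any constant, any exponent) agree with the theorem's letters up to N; in particular Q′ 0 = −P 0
(P2 #36g `polyLog_letters_unique`). [folklore] -/
theorem polyLog_inverse_unique (N : ℕ) {φ ψ : ℝ → ℝ} {P : ℕ → Polynomial ℝ} {A B : ℝ} {d e : ℕ}
    (hφ : ∀ᶠ y : ℝ in atTop, |(φ y - y) - ∑ k ∈ Finset.range (N + 1), (P k).eval (Real.log y) / y ^ k|
      ≤ A * (1 + Real.log y) ^ d / y ^ (N + 1))
    (hψ : Tendsto ψ atTop atTop)
    (hinv : ∀ᶠ s : ℝ in atTop, |φ (ψ s) - s| ≤ B * (1 + Real.log s) ^ e / s ^ (N + 1))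
    {Q' : ℕ → Polynomial ℝ} {A'' : ℝ} {d'' : ℕ}
    (h' : ∀ᶠ s : ℝ in atTop, |(ψ s - s) - ∑ k ∈ Finset.range (N + 1), (Q' k).eval (Real.log s) / s ^ k|
      ≤ A'' * (1 + Real.log s) ^ d'' / s ^ (N + 1)) :
    Q' 0 = -P 0 ∧
      ∃ (Q : ℕ → Polynomial ℝ) (A' : ℝ) (d' : ℕ), 0 ≤ A' ∧ (∀ k, k ≤ N → Q' k = Q k) ∧
        ∀ᶠ s : ℝ in atTop, |(ψ s - s) - ∑ k ∈ Finset.range (N + 1), (Q k).eval (Real.log s) / s ^ k|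
          ≤ A' * (1 + Real.log s) ^ d' / s ^ (N + 1) := by
  obtain ⟨Q, A', d', hQ0, hA', h⟩ := polyLog_inverse N hφ hψ hinv
  have hagree : ∀ k, k ≤ N → Q' k = Q k := polyLog_letters_unique N h' h
  exact ⟨(hagree 0 (Nat.zero_le N)).trans hQ0, Q, A', d', hA', hagree, h⟩

/-- **THE INVERSE OF THE INVERSE**: for a two-sided pair at ∞ (φ → ∞ as well and `|ψ(φ y) − y|` small), the inverse letters of any
letters Q of `ψ − id` are the letters P of `φ − id` again (up to N), and P 0 = −Q 0. [folklore] -/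
theorem polyLog_inverse_inverse (N : ℕ) {φ ψ : ℝ → ℝ} {P Q : ℕ → Polynomial ℝ} {A AQ B' : ℝ} {d dQ e' : ℕ}
    (hφ : ∀ᶠ y : ℝ in atTop, |(φ y - y) - ∑ k ∈ Finset.range (N + 1), (P k).eval (Real.log y) / y ^ k|
      ≤ A * (1 + Real.log y) ^ d / y ^ (N + 1))
    (hQ : ∀ᶠ s : ℝ in atTop, |(ψ s - s) - ∑ k ∈ Finset.range (N + 1), (Q k).eval (Real.log s) / s ^ k|
      ≤ AQ * (1 + Real.log s) ^ dQ / s ^ (N + 1))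
    (hφ' : Tendsto φ atTop atTop)
    (hinv' : ∀ᶠ y : ℝ in atTop, |ψ (φ y) - y| ≤ B' * (1 + Real.log y) ^ e' / y ^ (N + 1)) :
    P 0 = -Q 0 ∧
      ∃ (R : ℕ → Polynomial ℝ) (A' : ℝ) (d' : ℕ), 0 ≤ A' ∧ (∀ k, k ≤ N → P k = R k) ∧ R 0 = -Q 0 ∧
        ∀ᶠ y : ℝ in atTop, |(φ y - y) - ∑ k ∈ Finset.range (N + 1), (R k).eval (Real.log y) / y ^ k|
          ≤ A' * (1 + Real.log y) ^ d' / y ^ (N + 1) := by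
  obtain ⟨R, A', d', hR0, hA', h⟩ := polyLog_inverse N hQ hφ' hinv'
  have hagree : ∀ k, k ≤ N → P k = R k := polyLog_letters_unique N hφ h
  exact ⟨(hagree 0 (Nat.zero_le N)).trans hR0, R, A', d', hA', hagree, hR0, h⟩

/-- **THE INVERSE AS ONE ASYMPTOTIC SERIES**: if ONE letter sequence P carries the expansion of `φ − id` at EVERY order and ψ → ∞ is an
approximate right inverse at every order, then ONE letter sequence Q with Q 0 = −P 0 carries the expansion of `ψ − id` at EVERY order
(the diagonal of the order-by-order letters, coherent by `polyLog_letters_unique` + `polyLog_truncate`). [folklore] -/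
theorem polyLog_inverse_asymptoticSeries {φ ψ : ℝ → ℝ} {P : ℕ → Polynomial ℝ}
    (hφ : ∀ N : ℕ, ∃ (A : ℝ) (d : ℕ), ∀ᶠ y : ℝ in atTop,
      |(φ y - y) - ∑ k ∈ Finset.range (N + 1), (P k).eval (Real.log y) / y ^ k| ≤ A * (1 + Real.log y) ^ d / y ^ (N + 1))
    (hψ : Tendsto ψ atTop atTop)
    (hinv : ∀ N : ℕ, ∃ (B : ℝ) (e : ℕ), ∀ᶠ s : ℝ in atTop, |φ (ψ s) - s| ≤ B * (1 + Real.log s) ^ e / s ^ (N + 1)) :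
    ∃ Q : ℕ → Polynomial ℝ, Q 0 = -P 0 ∧
      ∀ N : ℕ, ∃ (A' : ℝ) (d' : ℕ), 0 ≤ A' ∧
        ∀ᶠ s : ℝ in atTop, |(ψ s - s) - ∑ k ∈ Finset.range (N + 1), (Q k).eval (Real.log s) / s ^ k|
          ≤ A' * (1 + Real.log s) ^ d' / s ^ (N + 1) := by
  have hN : ∀ N : ℕ, ∃ (Q : ℕ → Polynomial ℝ) (A' : ℝ) (d' : ℕ), Q 0 = -P 0 ∧ 0 ≤ A' ∧
      ∀ᶠ s : ℝ in atTop, |(ψ s - s) - ∑ k ∈ Finset.range (N + 1), (Q k).eval (Real.log s) / s ^ k|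
        ≤ A' * (1 + Real.log s) ^ d' / s ^ (N + 1) := by
    intro N
    obtain ⟨A, d, h⟩ := hφ N
    obtain ⟨B, e, hi⟩ := hinv N
    exact polyLog_inverse N h hψ hi
  choose Q A' d' hQ0 hA' hQ using hN
  have hcoh : ∀ (j M : ℕ), ∀ k, k ≤ M → Q (M + j) k = Q M k := by
    intro j M
    have hM : ∀ᶠ s : ℝ in atTop, |(ψ s - s) - ∑ k ∈ Finset.range (M + j + 1), (Q (M + j) k).eval (Real.log s) / s ^ k|
        ≤ A' (M + j) * (1 + Real.log s) ^ d' (M + j) / s ^ (M + j + 1) := hQ (M + j)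
    obtain ⟨A₁, d₁, h₁⟩ := polyLog_truncate (N := M) (P := Q (M + j)) j hM
    exact polyLog_letters_unique M h₁ (hQ M)
  refine ⟨fun k => Q k k, hQ0 0, fun N => ⟨A' N, d' N, hA' N, ?_⟩⟩
  filter_upwards [hQ N] with s hs
  have e : ∑ k ∈ Finset.range (N + 1), ((fun k => Q k k) k).eval (Real.log s) / s ^ k
      = ∑ k ∈ Finset.range (N + 1), (Q N k).eval (Real.log s) / s ^ k := by
    refine Finset.sum_congr rfl fun k hk => ?_
    have hkN : k ≤ N := Nat.lt_succ_iff.1 (Finset.mem_range.1 hk)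
    obtain ⟨j, hj⟩ : ∃ j, N = k + j := ⟨N - k, by omega⟩
    have := hcoh j k k le_rfl
    rw [← hj] at this
    simp only [this]
  rw [e]
  exact hs

end

end Summit.QuantumFields.BalabanUV.Beta.EriceFlowEnclosurePolyLogInversion
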